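import Mathlib
import Summits.MatrixMultiplication.MatrixMultiplication.Theses.FourierTwoFamiliesModP

/-!
# `PrimeTwoFamilies → cyclic ladders` — stub `cyclicLadder_of_primeTwoFamilies` (siege k6, explicit / elementary)

Crux `PrimeTwoFamilies` (stmt-MatrixMultiplication-14308, route `FourierTwoFamiliesModP`; CKSU 2005
Conj. 4.7 with prime cyclic hosts).  Line `Sketch` (`Cruxes/PrimeTwoFamilies/Lines/Sketch.lean`) reads
the crux through cyclic LADDERS in `ℤ/m`: classes `(X c, Y c)_{c<r}` with (i) every `X c ⊕ Y c` direct
and (ii) for classes `p < q` no lower cross difference `y' - x'` (`x' ∈ X p`, `y' ∈ Y q`) equal to a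
diagonal difference `y - x` (`x ∈ X c`, `y ∈ Y c`), with `r ≥ m^{1/2-ε}` classes of co-volume
`|X c| |Y c| ≥ m^{1-ε}`.  The registered stub `cyclicLadder_of_primeTwoFamilies` is the converse
direction *crux ⇒ ladders*; this file proves it verbatim, in one explicit elementary argument from
the route statement and Mathlib only.

Proof.  Given `ε > 0` and `m₀`, put `e := min ε (1/2)` and take an SDPP witness of the slice `δ := e`
with `n ≥ m₀·m₀ + 1` pairs `(A i, B i)` in `ℤ/p` (`p` prime, `p ≤ n^{2+e}`, `|A i| |B i| ≥ n^{2-e}`).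
The ladder is the witness itself: `m := p`, `r := n`, `X := A`, `Y := B`.
* (i) is clause (W) verbatim;
* (ii): `y - x = y' - x'` rewrites to `(x' - x) + (y - y') = 0`, and clause (X) at
  `(i, j, k) := (p, c, q)` forces `p = q`;
* `m₀ ≤ p`: otherwise `|A i| |B i| ≤ p·p ≤ m₀·m₀ < n ≤ n^{2-e}` (a finset of `ℤ/p` has at most `p`
  elements), contradicting the co-volume bound at the index `i = 0` (`n ≥ 1`);
* exponents: `p^{1/2-ε} ≤ p^{1/2-e} ≤ n^{(2+e)(1/2-e)} ≤ n` and
  `p^{1-ε} ≤ p^{1-e} ≤ n^{(2+e)(1-e)} ≤ n^{2-e} ≤ |A c| |B c|`, by monotonicity of `Real.rpow` in the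
  exponent (bases `p, n ≥ 1`) and in the base (exponents `1/2 - e, 1 - e ≥ 0`), using
  `(2+e)(1/2-e) ≤ 1` and `(2+e)(1-e) ≤ 2-e`.

Independent proofs of the same registered statement: `…Theorems.PrimeTwoFamilies.LadderLift.cyclicLadder_of_primeTwoFamilies`
(the lead's, via `p^{1/(2+δ)} ≤ n`) and `…Theorems.PrimeTwoFamilies.SiegeK17.cyclicLadder_of_primeTwoFamilies`.
-/

-- single-conjunct summit: the mandated namespace repeats `MatrixMultiplication` (summit = sub-problem).
set_option linter.dupNamespace false

namespace Summit.MatrixMultiplication.MatrixMultiplication.Theorems.PrimeTwoFamilies.SiegeK6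

open Summit.MatrixMultiplication.MatrixMultiplication.Theses

/-- **Crux ⇒ cyclic ladders** (registered stub `cyclicLadder_of_primeTwoFamilies` of crux
stmt-MatrixMultiplication-14308, line `Sketch`).  If `PrimeTwoFamilies` holds then for every `ε > 0`
and every `m₀` there is a modulus `m ≥ m₀` carrying a ladder `(X c, Y c)_{c<r}` in `ZMod m` —
(i) each `X c ⊕ Y c` direct, (ii) for `p < q` no cross difference `y' - x'` (`x' ∈ X p`, `y' ∈ Y q`)
equals a diagonal difference `y - x` (`x ∈ X c`, `y ∈ Y c`) — with `m^{1/2-ε} ≤ r` classes, each of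
co-volume `|X c| |Y c| ≥ m^{1-ε}`.  The ladder is an SDPP witness of the slice `min ε (1/2)` itself
(`m := p`, `X := A`, `Y := B`): (ii) is clause (X) at `(i, j, k) := (p, c, q)`, `m₀ ≤ p` by the crude
packing `|A i| |B i| ≤ p·p`, and the exponents follow from `p ≤ n^{2+δ}` by `rpow` monotonicity. -/
theorem cyclicLadder_of_primeTwoFamilies (hT : FourierTwoFamiliesModP.PrimeTwoFamilies) :
    ∀ ε : ℝ, 0 < ε → ∀ m₀ : ℕ, ∃ m ≥ m₀, ∃ r : ℕ, ∃ X Y : Fin r → Finset (ZMod m),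
      ((∀ c : Fin r, ∀ x ∈ X c, ∀ x' ∈ X c, ∀ y ∈ Y c, ∀ y' ∈ Y c,
          (x - x') + (y - y') = 0 → x = x' ∧ y = y') ∧
        (∀ c p q : Fin r, p < q → ∀ x ∈ X c, ∀ y ∈ Y c, ∀ x' ∈ X p, ∀ y' ∈ Y q,
          y - x ≠ y' - x')) ∧
      (m : ℝ) ^ (1 / 2 - ε) ≤ (r : ℝ) ∧
        ∀ c : Fin r, (m : ℝ) ^ (1 - ε) ≤ (((X c).card * (Y c).card : ℕ) : ℝ) := by
  intro ε hε m₀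
  -- the working slice `e := min ε (1/2)`: `0 < e ≤ ε` and `e ≤ 1/2`
  obtain ⟨e, he0, heε, he2⟩ : ∃ e : ℝ, 0 < e ∧ e ≤ ε ∧ e ≤ 1 / 2 :=
    ⟨min ε (1 / 2), lt_min hε (by norm_num), min_le_left _ _, min_le_right _ _⟩
  obtain ⟨n, hn, p, hp, A, B, hW, hX, hpn, hcard⟩ := hT e he0 (m₀ * m₀ + 1)
  have hn1 : 1 ≤ n := le_trans (Nat.le_add_left 1 _) hn
  have hn1' : (1 : ℝ) ≤ n := by exact_mod_cast hn1
  have hp1 : (1 : ℝ) ≤ p := by exact_mod_cast hp.one_lt.le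
  have hp0 : (0 : ℝ) ≤ p := Nat.cast_nonneg p
  haveI : NeZero p := ⟨hp.ne_zero⟩
  -- `n ≤ n ^ (2 - e)`, used for `m₀ ≤ p`
  have hnn : (n : ℝ) ≤ (n : ℝ) ^ (2 - e) :=
    calc (n : ℝ) = (n : ℝ) ^ (1 : ℝ) := (Real.rpow_one _).symm
      _ ≤ (n : ℝ) ^ (2 - e) := Real.rpow_le_rpow_of_exponent_le hn1' (by linarith)
  refine ⟨p, ?_, n, A, B, ⟨hW, ?_⟩, ?_, ?_⟩
  · -- `m₀ ≤ p`: crude packing `|A i₀| |B i₀| ≤ p·p` at the index `i₀ = 0`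
    refine not_lt.mp fun hlt => ?_
    obtain ⟨i₀⟩ : Nonempty (Fin n) := ⟨⟨0, hn1⟩⟩
    have hA : (A i₀).card ≤ p := (Finset.card_le_univ _).trans_eq (ZMod.card p)
    have hB : (B i₀).card ≤ p := (Finset.card_le_univ _).trans_eq (ZMod.card p)
    have hprod : (A i₀).card * (B i₀).card < n :=
      calc (A i₀).card * (B i₀).card ≤ p * p := Nat.mul_le_mul hA hB
        _ < m₀ * m₀ + 1 := Nat.lt_succ_of_le (Nat.mul_le_mul hlt.le hlt.le)
        _ ≤ n := hn
    have h1 : (((A i₀).card * (B i₀).card : ℕ) : ℝ) < (n : ℝ) := by exact_mod_cast hprod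
    exact lt_irrefl _ ((hnn.trans (hcard i₀)).trans_lt h1)
  · -- ladder clause (ii) from clause (X) at `(i, j, k) := (p, c, q)`
    intro c i k hik x hx y hy x' hx' y' hy' heq
    have h0 : (x' - x) + (y - y') = 0 := by linear_combination heq
    exact absurd (hX i c k x' hx' x hx y hy y' hy' h0) (ne_of_lt hik)
  · -- `p ^ (1/2 - ε) ≤ n`
    calc (p : ℝ) ^ (1 / 2 - ε) ≤ (p : ℝ) ^ (1 / 2 - e) :=
          Real.rpow_le_rpow_of_exponent_le hp1 (by linarith)
      _ ≤ ((n : ℝ) ^ (2 + e)) ^ (1 / 2 - e) := Real.rpow_le_rpow hp0 hpn (by linarith)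
      _ = (n : ℝ) ^ ((2 + e) * (1 / 2 - e)) := (Real.rpow_mul (Nat.cast_nonneg _) _ _).symm
      _ ≤ (n : ℝ) ^ (1 : ℝ) :=
          Real.rpow_le_rpow_of_exponent_le hn1' (by nlinarith [mul_pos he0 he0])
      _ = n := Real.rpow_one _
  · -- `p ^ (1 - ε) ≤ |A c| |B c|`
    intro c
    calc (p : ℝ) ^ (1 - ε) ≤ (p : ℝ) ^ (1 - e) :=
          Real.rpow_le_rpow_of_exponent_le hp1 (by linarith)
      _ ≤ ((n : ℝ) ^ (2 + e)) ^ (1 - e) := Real.rpow_le_rpow hp0 hpn (by linarith)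
      _ = (n : ℝ) ^ ((2 + e) * (1 - e)) := (Real.rpow_mul (Nat.cast_nonneg _) _ _).symm
      _ ≤ (n : ℝ) ^ (2 - e) :=
          Real.rpow_le_rpow_of_exponent_le hn1' (by nlinarith [mul_pos he0 he0])
      _ ≤ _ := hcard c

end Summit.MatrixMultiplication.MatrixMultiplication.Theorems.PrimeTwoFamilies.SiegeK6
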